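import Literature.Probability.LatticeModels.MagnetizationExponentUpperAFeSq
import HarnessLib

/-!
# The upper half of `β̂ = 1/2` above four dimensions (Aizenman–Fernández 1986), proofs IV:
# the integration step with the differential inequality restricted to `M ≤ 33 βh χ`

Topic `Probability/LatticeModels`, namespace `Literature.Probability.LatticeModels`. Fourth sibling
proof file of `MagnetizationExponentUpper.lean` (after `…Proofs`, `…AFe`, `…AFeSq`), opened by
the `provefact` unit of `Literature.Probability.LatticeModels.spontaneousMagnetization_le_sqrt`.
No definition and no named fact is introduced; everything stated is proved.

## Why this file

`MagnetizationExponentUpperAFe.lean` (Parts B, E) integrates an Aizenman–Fernández-type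
differential inequality `ū₃,L ≤ -κ tanh(βh) χ_L⁴`, assumed on the event `B βh ≤ a M_L`, to the
critical-isotherm bound `M ≤ C h^{1/3}` (Fernández–Fröhlich–Sokal 1992, §14.4.2, Step 1;
Aizenman–Fernández 1986, §2.1, (2.2)–(2.4): integrate at fixed `β < β_c`, where `M(β, 0) = 0`).
The source of that inequality is Aizenman–Fernández 1986, Thm. 5.7 (b), eq. (5.33), p. 435, proved
on pp. 436–441 by the random-current representation, the "dilution trick" and the random-walk
expansion of their §4 (kernel `K`, Props. 4.6–4.8, Lemma 5.5). Two remarks on that printed proof,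
read on the held author copy (`paper:url-b8cebc3f44bb`, PDF page = journal page − 392):

1. Step (5.49), p. 439 — "`R ≤ [⟨σ₀σ_k⟩_{h=0} T(0,u,x) + (u ⇔ k)] + [k ⇔ l]`" with
   `T(0,u,x) = ∑_{∂n₁={0}Δ{x}, ∂n₂=∅} (W W/Z Z) 𝟙[n₁+n₂ : 0 ↛ h] 𝟙[n₁+n₂ : 0 ↔ u]` ((5.44)) —
   does not follow from Lemma 5.4 ((5.13), p. 428) as indicated: conditioning on
   `C^c_{n₁+n₂}(h)` and (5.13) with `(x,u,y,l) := (0,u,x,k)` bound the inner sum by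
   `⟨σ₀σ_k⟩⟨σ_kσ_u⟩⟨σ_uσ_x⟩ + ⟨σ_xσ_k⟩⟨σ_kσ_u⟩⟨σ_uσ₀⟩` (all in `C^c(h)`), and taking
   `⟨σ₀σ_k⟩_{C^c(h)} ≤ ⟨σ₀σ_k⟩_{h=0}` out leaves `E{⟨σ_kσ_u⟩⟨σ_uσ_x⟩} = T(k,u,x)`, with base
   point `k`, not `T(0,u,x)`; and the displayed (5.49) is false at `u = k` (where `R = T(0,u,x)`)
   as soon as `⟨σ₀σ_u⟩_{h=0} < 1/2`. With base point `k` the Schwarz step (5.51) produces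
   `∑_k ⟨σ₀σ_k⟩_{h=0} = χ(β, h = 0)`, unbounded as `β ↑ β_c`, instead of the bubble.
2. A corrected estimate of the second-order dilution term that avoids §4 altogether keeps the
   "disconnected" two-pair quantity `∑_{∂n₁={0,k},∂n₂={u,x}} 𝟙[0 ↮ g] 𝟙[u ↮ g]` and bounds its
   `(k, x)`-sums by `(M/βh)²` (injecting one unit of current on a ghost edge), instead of by
   `∑_{u,x} T(0,u,x) ≥ χ²`. The resulting lower bound on `|∂χ/∂(βh)|` is the printed one times
   `(βhχ/M)²` — a factor `≤ 1` by the weak GHS inequality `βhχ ≤ M` — i.e. it has full strength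
   exactly where `M ≤ R βh χ` for a fixed `R`.

This file shows that such a **restricted** differential inequality still integrates to
`M ≤ C (βh)^{1/3}` (Part A), and re-threads the torus reductions of the parent files onto it
(Parts B–C). The point of Part A: where `M > 3 sχ` (`s = βh`, `χ = ∂M/∂s`) the function
`M/s^{1/3}` is nonincreasing, and since `M/χ - s` is nondecreasing (`∂χ/∂s = ū₃ ≤ 0`, GHS), after
any point with `M ≥ 33 sχ` the ratio `M/(sχ)` stays `≥ 3` for a factor `16` in `s`; so at a
maximiser `s*` of `M/s^{1/3}` the inequality is available on `(s*/16, s*]`, which is enough room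
to integrate it twice (`(χ⁻³)' ≥ 3κ s'` on `[s/2, s]`, then `M' = χ ≤ (8/(9κ))^{1/3} s^{-2/3}` on
`[s*/8, s*]`, and `M(s*/8) ≤ M(s*)/2` by maximality).

## What is proved here

* Part A, `le_cbrt_of_afe_ode_restricted`: for real `m, χ, u` on `(0, S]`, `S ≤ 1`, with
  `m' = χ > 0`, `χ' = u ≤ 0`, `m ≤ K₀ s`, decreasing chord slopes, and `u ≤ -κ s χ⁴` wherever
  `B s ≤ a m(s)` and `m(s) ≤ 33 s χ(s)`: `m(s) ≤ max(B/a, 6 (8/(9κ))^{1/3}) s^{1/3}`.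
* Part B, `torusMag_le_susc_zero_mul` (`M_L(β,h) ≤ βχ_L(β,0) h`, tangent at the origin of the
  concave `M_L`), `torusMag_le_cbrt_of_afeShapeR` (FFS Step 1 on one torus, restricted form; uses
  `torusU3_nonpos` of `…AFeSq`).
* Part C, `criticalIsotherm_le_cbrt_of_torusShapeR`, `spontaneousMagnetization_le_sqrt_of_torusShapeR`:
  the critical-isotherm bound and the named fact `spontaneousMagnetization_le_sqrt` from the
  restricted shape hypothesis on large tori below `β_c` (as Part E of `…AFe`, with the extra
  premise `M_L ≤ 33 βh χ_L` and `βh` in place of `tanh(βh)`).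

## References

* M. Aizenman, R. Fernández, J. Stat. Phys. **44** (1986) 393–454: §2.1, (2.2)–(2.4), p. 401;
  Lemma 5.4, (5.13), p. 428; Thm. 5.7 (b), (5.33), p. 435; proof, (5.41)–(5.51), pp. 438–441
  [AizenmanFernandezJSP1986] (held: author copy `paper:url-b8cebc3f44bb`).
* R. Fernández, J. Fröhlich, A. D. Sokal, *Random Walks, Critical Phenomena, and Triviality in
  Quantum Field Theory*, Springer 1992, §14.4.2, Step 1, (14.278)–(14.281), pp. 352–353
  [FernandezFrohlichSokalSpringer1992] (held: `paper:url-4966219460f8`).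
* J. L. Lebowitz, Comm. Math. Phys. **35** (1974) 87, eq. (1.8) (GHS) [Lebowitz1974].

## Mathlib

`IsCompact.exists_isMaxOn`, `mem_nhdsGT_iff_exists_Ioo_subset`, `HasDerivAt.tendsto_slope`,
`ge_of_tendsto`, `exists_lt_of_lt_csSup`, `le_csSup`/`csSup_le`, `monotoneOn_of_deriv_nonneg`,
`Real.rpow` algebra (`Real.rpow_add`, `Real.div_rpow`, `Real.pow_rpow_inv_natCast`).
-/

noncomputable section

open MeasureTheory Filter Finset Set
open scoped Topology

namespace Literature.Probability.LatticeModels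

/-! ## Part A. The restricted integration lemma -/

section RestrictedODE

/-- `8^{1/3} = 2`. [folklore] -/
theorem rpow_eight_third : (8 : ℝ) ^ (1 / 3 : ℝ) = 2 := by
  rw [show (8 : ℝ) = 2 ^ ((3 : ℕ) : ℝ) by norm_num, ← Real.rpow_mul (by norm_num)]
  norm_num

/-- **Restricted integration lemma.** Let `m, χ, u` be real functions on `(0, S]`, `S ≤ 1`, with
`m' = χ > 0`, `χ' = u ≤ 0`, `m(0⁺) = 0`, `m(s) ≤ K₀ s`, decreasing chord slopes `s ↦ m(s)/s`, and
suppose the AFe-type inequality `u ≤ -κ s χ⁴` holds at every `s` with `B s ≤ a m(s)` **and**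
`m(s) ≤ 33 s χ(s)`. Then `m(s) ≤ max(B/a, 6 (8/(9κ))^{1/3}) s^{1/3}` on `(0, S]`. (At a maximiser
`s*` of `f = m/s^{1/3}` over `(0, h]` one has `m(s*) ≤ 3 s* χ(s*)`; if `s₁ ≤ s*` is the last point
with `m ≥ 33 s χ`, monotonicity of `m/χ - s` gives `s* ≥ 16 s₁`, the inequality holds on
`(s₁, s*]`, `(χ⁻³)' ≥ 3κ s` on `[s/2, s]` gives `χ(s) ≤ (8/(9κ))^{1/3} s^{-2/3}` for
`s ∈ [s*/8, s*]`, and `m(s*) ≤ m(s*/8) + 3 (8/(9κ))^{1/3} s*^{1/3} ≤ m(s*)/2 + 3 (8/(9κ))^{1/3} s*^{1/3}`.)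
Deviation from the printed argument of Fernández–Fröhlich–Sokal, §14.4.2, Step 1 (which assumes
the inequality for all `h`): only the restricted inequality is used. [cite: FernandezFrohlichSokalSpringer1992, §14.4.2, Step 1, eqs. (14.278)–(14.281), pp. 352–353] [cite: AizenmanFernandezJSP1986, §2.1, eqs. (2.2)–(2.4), p. 401] -/
theorem le_cbrt_of_afe_ode_restricted {m χ u : ℝ → ℝ} {S B a κ K₀ : ℝ} (hS1 : S ≤ 1)
    (ha : 0 < a) (hB : 0 ≤ B) (hκ : 0 < κ)
    (hm : ∀ s ∈ Ioc 0 S, HasDerivAt m (χ s) s)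
    (hχ : ∀ s ∈ Ioc 0 S, HasDerivAt χ (u s) s)
    (hlin : ∀ s ∈ Ioc 0 S, m s ≤ K₀ * s)
    (hslope : ∀ s ∈ Ioc 0 S, ∀ s' ∈ Ioc 0 s, m s / s ≤ m s' / s')
    (hχpos : ∀ s ∈ Ioc 0 S, 0 < χ s)
    (hu : ∀ s ∈ Ioc 0 S, u s ≤ 0)
    (hafe : ∀ s ∈ Ioc 0 S, B * s ≤ a * m s → m s ≤ 33 * (s * χ s) → u s ≤ -(κ * s * χ s ^ 4)) :
    ∀ s ∈ Ioc 0 S, m s ≤ max (B / a) (6 * (8 / (9 * κ)) ^ (1 / 3 : ℝ)) * s ^ (1 / 3 : ℝ) := by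
  intro h hh
  have hh0 : 0 < h := hh.1
  have hh1 : h ≤ 1 := hh.2.trans hS1
  have hrpow : h ≤ h ^ (1 / 3 : ℝ) := self_le_rpow_third hh0 hh1
  have hrpow0 : 0 ≤ h ^ (1 / 3 : ℝ) := Real.rpow_nonneg hh0.le _
  set K₁ : ℝ := (8 / (9 * κ)) ^ (1 / 3 : ℝ) with hK₁
  have hK₁0 : 0 ≤ K₁ := Real.rpow_nonneg (by positivity) _
  have hsub : Ioc 0 h ⊆ Ioc 0 S := Ioc_subset_Ioc le_rfl hh.2
  by_cases hcase : B * h ≤ a * m h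
  swap
  · -- Case 1 of FFS: `B h > a m(h)`, so `m(h) < (B/a) h ≤ (B/a) h^{1/3}`
    rw [not_le] at hcase
    have h1 : m h < B / a * h := by
      rw [div_mul_eq_mul_div, lt_div_iff₀ ha]
      linarith
    have h2 : B / a * h ≤ B / a * h ^ (1 / 3 : ℝ) :=
      mul_le_mul_of_nonneg_left hrpow (div_nonneg hB ha.le)
    calc m h ≤ B / a * h ^ (1 / 3 : ℝ) := (h1.trans_le h2).le
      _ ≤ max (B / a) (6 * K₁) * h ^ (1 / 3 : ℝ) :=
          mul_le_mul_of_nonneg_right (le_max_left _ _) hrpow0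
  -- Case 2 of FFS: the smallness condition holds at `h`, hence on all of `(0, h]`
  have hsmall : ∀ s ∈ Ioc 0 h, B * s ≤ a * m s := by
    intro s hs
    have h1 := hslope h hh s hs
    rw [div_le_div_iff₀ hh0 hs.1] at h1
    have h3 : B * s * h ≤ a * m s * h := by
      nlinarith [mul_le_mul_of_nonneg_left h1 ha.le, mul_le_mul_of_nonneg_right hcase hs.1.le]
    exact le_of_mul_le_mul_right h3 hh0
  have hode : ∀ s ∈ Ioc 0 h, m s ≤ 33 * (s * χ s) → u s ≤ -(κ * s * χ s ^ 4) := fun s hs hr =>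
    hafe s (hsub hs) (hsmall s hs) hr
  -- the function `f = m s^{-1/3}` and its derivative
  set f : ℝ → ℝ := fun s => m s * s ^ (-(1 / 3) : ℝ) with hf
  have hfder : ∀ s ∈ Ioc 0 h, HasDerivAt f
      (χ s * s ^ (-(1 / 3) : ℝ) + m s * (-(1 / 3) * s ^ (-(1 / 3) - 1 : ℝ))) s := by
    intro s hs
    exact (hm s (hsub hs)).mul (Real.hasDerivAt_rpow_const (Or.inl hs.1.ne'))
  have hfcont : ContinuousOn f (Ioc 0 h) := fun s hs =>
    (hfder s hs).continuousAt.continuousWithinAt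
  -- trivial if `f h ≤ 0`
  by_cases hFpos : f h ≤ 0
  · have hmh : m h ≤ 0 := by
      have e : m h = f h * h ^ (1 / 3 : ℝ) := by
        simp only [hf]
        rw [mul_assoc, ← Real.rpow_add hh0]; norm_num
      rw [e]
      exact mul_nonpos_of_nonpos_of_nonneg hFpos hrpow0
    exact hmh.trans (mul_nonneg (le_max_of_le_right (by positivity)) hrpow0)
  rw [not_le] at hFpos
  -- Step A: a maximiser `s*` of `f` on `(0, h]`
  -- near `0⁺`, `f ≤ K₀ s^{2/3} < f h`
  have hev : ∀ᶠ s in 𝓝[>] (0 : ℝ), s ∈ Ioc 0 h ∧ f s < f h := by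
    have hc : Tendsto (fun s : ℝ => K₀ * s ^ (2 / 3 : ℝ)) (𝓝[>] 0) (𝓝 0) := by
      have h1 : Tendsto (fun s : ℝ => K₀ * s ^ (2 / 3 : ℝ)) (𝓝 0) (𝓝 (K₀ * (0 : ℝ) ^ (2 / 3 : ℝ))) :=
        (continuous_const.mul (Real.continuous_rpow_const (by norm_num))).tendsto 0
      rw [Real.zero_rpow (by norm_num), mul_zero] at h1
      exact h1.mono_left nhdsWithin_le_nhds
    have h2 : ∀ᶠ s in 𝓝[>] (0 : ℝ), K₀ * s ^ (2 / 3 : ℝ) < f h := hc (Iio_mem_nhds hFpos)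
    filter_upwards [h2, Ioo_mem_nhdsGT hh0] with s hs1 hs2
    have hsI : s ∈ Ioc 0 h := ⟨hs2.1, hs2.2.le⟩
    refine ⟨hsI, lt_of_le_of_lt ?_ hs1⟩
    simp only [hf]
    have e : K₀ * s ^ (2 / 3 : ℝ) = K₀ * s * s ^ (-(1 / 3) : ℝ) := by
      rw [mul_assoc, ← Real.rpow_one_add' hs2.1.le (by norm_num)]; norm_num
    rw [e]
    exact mul_le_mul_of_nonneg_right (hlin s (hsub hsI)) (Real.rpow_nonneg hs2.1.le _)
  obtain ⟨b, hb0, hb⟩ : ∃ b ∈ Ioi (0 : ℝ), Ioo 0 b ⊆ {s | s ∈ Ioc 0 h ∧ f s < f h} :=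
    mem_nhdsGT_iff_exists_Ioo_subset.1 hev
  set δ : ℝ := min (b / 2) h with hδ
  have hδ0 : 0 < δ := lt_min (half_pos hb0) hh0
  have hδh : δ ≤ h := min_le_right _ _
  have hδb : δ < b := (min_le_left _ _).trans_lt (half_lt_self hb0)
  obtain ⟨sm, hsmI, hsmax⟩ : ∃ sm ∈ Icc δ h, IsMaxOn f (Icc δ h) sm :=
    (isCompact_Icc).exists_isMaxOn (nonempty_Icc.2 hδh)
      (hfcont.mono fun s hs => ⟨hδ0.trans_le hs.1, hs.2⟩)
  have hsm0 : 0 < sm := hδ0.trans_le hsmI.1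
  have hsmh : sm ≤ h := hsmI.2
  have hsmIoc : sm ∈ Ioc 0 h := ⟨hsm0, hsmh⟩
  -- `f s ≤ f sm` on all of `(0, h]`
  have hfmax : ∀ s ∈ Ioc 0 h, f s ≤ f sm := by
    intro s hs
    by_cases hsδ : δ ≤ s
    · exact hsmax ⟨hsδ, hs.2⟩
    · rw [not_le] at hsδ
      have h1 : f s < f h := (hb ⟨hs.1, hsδ.trans hδb⟩).2
      have h2 : f h ≤ f sm := hsmax ⟨hδh, le_rfl⟩
      exact (h1.trans_le h2).le
  -- hence `f'(sm) ≥ 0` (left difference quotients), i.e. `m(sm) ≤ 3 sm χ(sm)`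
  have hr3 : m sm ≤ 3 * (sm * χ sm) := by
    have hder := hfder sm hsmIoc
    have hslope_t : Tendsto (slope f sm) (𝓝[<] sm)
        (𝓝 (χ sm * sm ^ (-(1 / 3) : ℝ) + m sm * (-(1 / 3) * sm ^ (-(1 / 3) - 1 : ℝ)))) :=
      hder.tendsto_slope.mono_left (nhdsWithin_mono _ fun s hs => ne_of_lt hs)
    have hnonneg : 0 ≤ χ sm * sm ^ (-(1 / 3) : ℝ) + m sm * (-(1 / 3) * sm ^ (-(1 / 3) - 1 : ℝ)) := by
      refine ge_of_tendsto hslope_t ?_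
      filter_upwards [Ioo_mem_nhdsLT hsm0] with s hs
      rw [slope_def_field]
      have h1 : f s ≤ f sm := hfmax s ⟨hs.1, hs.2.le.trans hsmh⟩
      exact div_nonneg_of_nonpos (by linarith) (by linarith [hs.2])
    -- multiply by `sm^{4/3} > 0`
    have e1 : sm ^ (-(1 / 3) : ℝ) * sm ^ (4 / 3 : ℝ) = sm := by
      rw [← Real.rpow_add hsm0]; norm_num
    have e2 : sm ^ (-(1 / 3) - 1 : ℝ) * sm ^ (4 / 3 : ℝ) = 1 := by
      rw [← Real.rpow_add hsm0]; norm_num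
    have h43 : 0 < sm ^ (4 / 3 : ℝ) := Real.rpow_pos_of_pos hsm0 _
    have := mul_nonneg hnonneg h43.le
    have e3 : (χ sm * sm ^ (-(1 / 3) : ℝ) + m sm * (-(1 / 3) * sm ^ (-(1 / 3) - 1 : ℝ))) *
        sm ^ (4 / 3 : ℝ) = χ sm * sm - m sm / 3 := by
      have := e1; have := e2
      linear_combination χ sm * e1 - m sm / 3 * e2
    rw [e3] at this
    linarith
  -- Step B: `ψ = m/χ - s` is nondecreasing on `(0, h]`
  set ψ : ℝ → ℝ := fun s => m s / χ s - s with hψ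
  have hψder : ∀ s ∈ Ioc 0 h, HasDerivAt ψ ((χ s * χ s - m s * u s) / χ s ^ 2 - 1) s := by
    intro s hs
    exact ((hm s (hsub hs)).div (hχ s (hsub hs)) (hχpos s (hsub hs)).ne').sub (hasDerivAt_id s)
  have hψmono : MonotoneOn ψ (Ioc 0 h) := by
    refine monotoneOn_of_deriv_nonneg (convex_Ioc 0 h)
      (fun s hs => (hψder s hs).continuousAt.continuousWithinAt) (fun s hs => ?_) (fun s hs => ?_)
    · rw [interior_Ioc] at hs
      exact (hψder s (Ioo_subset_Ioc_self hs)).differentiableAt.differentiableWithinAt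
    · rw [interior_Ioc] at hs
      have hs' : s ∈ Ioc 0 h := Ioo_subset_Ioc_self hs
      rw [(hψder s hs').deriv]
      have hχs := hχpos s (hsub hs')
      have hms : 0 ≤ m s := by
        -- `m s ≥ s χ s > 0` from the chord-slope monotonicity would do; we only need `-m u ≥ 0`
        -- via `m ≥ 0`: `m(s) ≥ (s/s') m(s')`-type bounds are not needed, use `f`-free argument:
        -- `m s / s ≥ m h / h`-direction is the wrong one, so argue from `m ≤ 33 s χ`? No: use
        -- `m s = f s * s^{1/3}` and `f s`… also unknown. Simplest: chord slopes give
        -- `m s ≥ (s / h) * m h > 0`? That is `m h / h ≤ m s / s`, i.e. `hslope h hh s hs'`.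
        have h1 := hslope h hh s hs'
        rw [div_le_div_iff₀ hh0 hs.1] at h1
        have hmh : 0 < m h := by
          have e : m h = f h * h ^ (1 / 3 : ℝ) := by
            simp only [hf]; rw [mul_assoc, ← Real.rpow_add hh0]; norm_num
          rw [e]; exact mul_pos hFpos (Real.rpow_pos_of_pos hh0 _)
        nlinarith [mul_pos hmh hs.1, hh0]
      have hnum : χ s ^ 2 ≤ χ s * χ s - m s * u s := by
        nlinarith [hu s (hsub hs'), hms]
      rw [sub_nonneg, le_div_iff₀ (pow_pos hχs 2)]
      linarith
  -- the last bad point: `t = sup {s ∈ (0, sm] : 33 s χ(s) ≤ m(s)}` (or `0`)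
  set Bad : Set ℝ := {s | s ∈ Ioc 0 sm ∧ 33 * (s * χ s) ≤ m s} with hBad
  have hBadbdd : BddAbove Bad := ⟨sm, fun s hs => hs.1.2⟩
  -- (T1)–(T2): a threshold `t` with `16 t ≤ sm` beyond which the ODE holds
  obtain ⟨t, ht0, ht16, hgood⟩ : ∃ t : ℝ, 0 ≤ t ∧ 16 * t ≤ sm ∧
      ∀ s ∈ Ioc t sm, m s < 33 * (s * χ s) := by
    by_cases hne : Bad.Nonempty
    · set t := sSup Bad with ht
      have htmem : ∀ s ∈ Bad, s ≤ t := fun s hs => le_csSup hBadbdd hs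
      have htsm : t ≤ sm := csSup_le hne fun s hs => hs.1.2
      obtain ⟨s₀, hs₀⟩ := hne
      have ht0 : 0 < t := hs₀.1.1.trans_le (htmem s₀ hs₀)
      have htIoc : t ∈ Ioc 0 h := ⟨ht0, htsm.trans hsmh⟩
      -- closedness: `33 t χ(t) ≤ m(t)`
      have htbad : 33 * (t * χ t) ≤ m t := by
        by_contra hcon
        rw [not_le] at hcon
        -- continuity of `s ↦ 33 s χ s - m s` at `t`
        have hcm : ContinuousAt m t := (hm t (hsub htIoc)).continuousAt
        have hcχ : ContinuousAt χ t := (hχ t (hsub htIoc)).continuousAt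
        have hc : ContinuousAt (fun s => 33 * (s * χ s) - m s) t :=
          ((continuousAt_const.mul (continuousAt_id.mul hcχ)).sub hcm)
        have hpos : 0 < 33 * (t * χ t) - m t := by linarith
        have hev' : ∀ᶠ s in 𝓝 t, 0 < 33 * (s * χ s) - m s := hc (Ioi_mem_nhds hpos)
        obtain ⟨ε, hε, hεsub⟩ := Metric.eventually_nhds_iff.1 hev'
        obtain ⟨s, hsBad, hts⟩ := exists_lt_of_lt_csSup ⟨s₀, hs₀⟩ (show t - ε < t by linarith)
        have hst : s ≤ t := htmem s hsBad
        have hdist : dist s t < ε := by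
          rw [Real.dist_eq, abs_sub_lt_iff]; constructor <;> linarith
        have := hεsub hdist
        linarith [hsBad.2]
      -- `ψ t ≥ 32 t` and `ψ sm ≤ 2 sm`
      have hχt := hχpos t (hsub htIoc)
      have hψt : 32 * t ≤ ψ t := by
        simp only [hψ]
        rw [le_sub_iff_add_le, le_div_iff₀ hχt]
        linarith
      have hψsm : ψ sm ≤ 2 * sm := by
        simp only [hψ]
        rw [sub_le_iff_le_add, div_le_iff₀ (hχpos sm (hsub hsmIoc))]
        linarith
      have hmono := hψmono htIoc hsmIoc htsm
      refine ⟨t, ht0.le, by linarith, fun s hs => ?_⟩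
      by_contra hcon
      rw [not_lt] at hcon
      have hsBad : s ∈ Bad := ⟨⟨ht0.trans hs.1, hs.2⟩, hcon⟩
      exact absurd (htmem s hsBad) (not_le.2 hs.1)
    · refine ⟨0, le_rfl, by linarith, fun s hs => ?_⟩
      by_contra hcon
      rw [not_lt] at hcon
      exact hne ⟨s, ⟨hs.1, hs.2⟩, hcon⟩
  -- Step C: `χ(s) ≤ K₁ s^{-2/3}` for `s ∈ [sm/8, sm]` (integrate `(χ⁻³)' ≥ 3κ s'` over `[s/2, s]`)
  have hχle : ∀ s ∈ Ioc 0 h, sm ≤ 8 * s → s ≤ sm → χ s ≤ K₁ * s ^ (-(2 / 3) : ℝ) := by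
    intro s hs h8 hssm
    have hs0 := hs.1
    -- the ODE holds on `(s/2, s]`
    have hodeI : ∀ s' ∈ Ioc (s / 2) s, u s' ≤ -(κ * s' * χ s' ^ 4) := by
      intro s' hs'
      have hs'I : s' ∈ Ioc 0 h := ⟨by linarith [hs'.1], hs'.2.trans hs.2⟩
      exact hode s' hs'I (le_of_lt (hgood s' ⟨lt_of_le_of_lt (by linarith) hs'.1, hs'.2.trans hssm⟩))
    set g : ℝ → ℝ := fun s => (χ s ^ 3)⁻¹ - 3 * κ / 2 * s ^ 2 with hg
    have hIsub : Icc (s / 2) s ⊆ Ioc 0 h := fun s' hs' => ⟨by linarith [hs'.1], hs'.2.trans hs.2⟩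
    have hgder : ∀ s' ∈ Icc (s / 2) s, HasDerivAt g
        (-(↑(3 : ℕ) * χ s' ^ (3 - 1) * u s') / (χ s' ^ 3) ^ 2 - 3 * κ / 2 * (↑(2 : ℕ) * s' ^ (2 - 1))) s' := by
      intro s' hs'
      have hχs := hχpos s' (hsub (hIsub hs'))
      have h1 := ((hχ s' (hsub (hIsub hs'))).pow 3).inv (pow_ne_zero 3 hχs.ne')
      have h2 := (hasDerivAt_pow 2 s').const_mul (3 * κ / 2)
      exact h1.sub h2
    have hgmono : MonotoneOn g (Icc (s / 2) s) := by
      refine monotoneOn_of_deriv_nonneg (convex_Icc _ _)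
        (fun s' hs' => (hgder s' hs').continuousAt.continuousWithinAt)
        (fun s' hs' => ?_) (fun s' hs' => ?_)
      · rw [interior_Icc] at hs'
        exact (hgder s' (Ioo_subset_Icc_self hs')).differentiableAt.differentiableWithinAt
      · rw [interior_Icc] at hs'
        rw [(hgder s' (Ioo_subset_Icc_self hs')).deriv]
        have hχs := hχpos s' (hsub (hIsub (Ioo_subset_Icc_self hs')))
        have hu' := hodeI s' ⟨hs'.1, hs'.2.le⟩
        have hrew : -(↑(3 : ℕ) * χ s' ^ (3 - 1) * u s') / (χ s' ^ 3) ^ 2 -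
            3 * κ / 2 * (↑(2 : ℕ) * s' ^ (2 - 1)) = 3 * (-u s' / χ s' ^ 4 - κ * s') := by
          push_cast
          field_simp
        rw [hrew]
        refine mul_nonneg (by norm_num) (sub_nonneg.2 ?_)
        rw [le_div_iff₀ (pow_pos hχs 4)]
        linarith
    have hgs : g (s / 2) ≤ g s := hgmono (left_mem_Icc.2 (by linarith)) (right_mem_Icc.2 (by linarith))
      (by linarith)
    have hχs := hχpos s (hsub hs)
    have h1 : 9 * κ / 8 * s ^ 2 ≤ (χ s ^ 3)⁻¹ := by
      have hpos : 0 ≤ (χ (s / 2) ^ 3)⁻¹ :=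
        inv_nonneg.2 (pow_nonneg (hχpos (s / 2) (hsub ⟨by linarith, by linarith [hs.2]⟩)).le 3)
      simp only [hg] at hgs
      nlinarith
    have hks : 0 < 9 * κ / 8 * s ^ 2 := by positivity
    have h2 : χ s ^ 3 ≤ (9 * κ / 8 * s ^ 2)⁻¹ := (le_inv_comm₀ hks (pow_pos hχs 3)).1 h1
    have h3 : χ s = (χ s ^ 3) ^ (1 / 3 : ℝ) := by
      rw [one_div]
      exact (Real.pow_rpow_inv_natCast hχs.le (by norm_num : (3 : ℕ) ≠ 0)).symm
    have h4 : (χ s ^ 3) ^ (1 / 3 : ℝ) ≤ ((9 * κ / 8 * s ^ 2)⁻¹) ^ (1 / 3 : ℝ) :=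
      Real.rpow_le_rpow (pow_nonneg hχs.le 3) h2 (by norm_num)
    have h5 : ((9 * κ / 8 * s ^ 2)⁻¹) ^ (1 / 3 : ℝ) = K₁ * s ^ (-(2 / 3) : ℝ) := by
      rw [hK₁, show (9 * κ / 8 * s ^ 2)⁻¹ = (8 / (9 * κ)) * (s ^ 2)⁻¹ by field_simp,
        Real.mul_rpow (by positivity) (by positivity)]
      congr 1
      rw [← Real.rpow_natCast s 2, ← Real.rpow_neg hs0.le, ← Real.rpow_mul hs0.le]
      norm_num
    rw [h3]
    exact h4.trans_eq h5
  -- Step D: `m(sm) ≤ m(sm/8) + 3 K₁ sm^{1/3}` and `m(sm/8) ≤ m(sm)/2`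
  set F : ℝ → ℝ := fun s => 3 * K₁ * s ^ (1 / 3 : ℝ) with hF
  have hsm8 : sm / 8 ∈ Ioc 0 h := ⟨by positivity, by linarith⟩
  have hJsub : Icc (sm / 8) sm ⊆ Ioc 0 h := fun s hs => ⟨by linarith [hs.1], hs.2.trans hsmh⟩
  have hFmder : ∀ s ∈ Icc (sm / 8) sm, HasDerivAt (fun s => F s - m s)
      (3 * K₁ * (1 / 3 * s ^ (1 / 3 - 1 : ℝ)) - χ s) s := by
    intro s hs
    have hs0 : 0 < s := (hJsub hs).1
    exact ((Real.hasDerivAt_rpow_const (Or.inl hs0.ne')).const_mul (3 * K₁)).sub (hm s (hsub (hJsub hs)))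
  have hFm_mono : MonotoneOn (fun s => F s - m s) (Icc (sm / 8) sm) := by
    refine monotoneOn_of_deriv_nonneg (convex_Icc _ _)
      (fun s hs => (hFmder s hs).continuousAt.continuousWithinAt) (fun s hs => ?_) (fun s hs => ?_)
    · rw [interior_Icc] at hs
      exact (hFmder s (Ioo_subset_Icc_self hs)).differentiableAt.differentiableWithinAt
    · rw [interior_Icc] at hs
      have hs' : s ∈ Icc (sm / 8) sm := Ioo_subset_Icc_self hs
      rw [(hFmder s hs').deriv]
      have h1 := hχle s (hJsub hs') (by linarith [hs.1]) hs.2.le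
      have h2 : 3 * K₁ * (1 / 3 * s ^ (1 / 3 - 1 : ℝ)) = K₁ * s ^ (-(2 / 3) : ℝ) := by
        rw [show (1 / 3 - 1 : ℝ) = -(2 / 3) by norm_num]; ring
      rw [h2]
      linarith
  have hstep : F (sm / 8) - m (sm / 8) ≤ F sm - m sm :=
    hFm_mono (left_mem_Icc.2 (by linarith)) (right_mem_Icc.2 (by linarith)) (by linarith)
  have hF8 : 0 ≤ F (sm / 8) := by simp only [hF]; positivity
  -- `m(sm/8) ≤ f(sm) (sm/8)^{1/3} = m(sm)/2`
  have e_sm : m sm = f sm * sm ^ (1 / 3 : ℝ) := by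
    simp only [hf]; rw [mul_assoc, ← Real.rpow_add hsm0]; norm_num
  have hm8 : m (sm / 8) ≤ m sm / 2 := by
    have h1 : f (sm / 8) ≤ f sm := hfmax _ hsm8
    have e8 : m (sm / 8) = f (sm / 8) * (sm / 8) ^ (1 / 3 : ℝ) := by
      simp only [hf]; rw [mul_assoc, ← Real.rpow_add hsm8.1]; norm_num
    have e8' : (sm / 8) ^ (1 / 3 : ℝ) = sm ^ (1 / 3 : ℝ) / 2 := by
      rw [Real.div_rpow hsm0.le (by norm_num), rpow_eight_third]
    have hfsm : 0 ≤ f sm := by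
      have := hfmax h ⟨hh0, le_rfl⟩
      linarith
    rw [e8, e8', e_sm]
    have hr0 : 0 ≤ sm ^ (1 / 3 : ℝ) / 2 := by positivity
    nlinarith [mul_le_mul_of_nonneg_right h1 hr0]
  have hmsm : m sm ≤ 6 * K₁ * sm ^ (1 / 3 : ℝ) := by
    have : F sm = 3 * K₁ * sm ^ (1 / 3 : ℝ) := rfl
    linarith
  -- conclusion at `h`: `f h ≤ f sm ≤ 6 K₁`
  have hfsm : f sm ≤ 6 * K₁ := by
    have hr : 0 < sm ^ (1 / 3 : ℝ) := Real.rpow_pos_of_pos hsm0 _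
    rw [e_sm] at hmsm
    exact le_of_mul_le_mul_right (by linarith) hr
  have e_h : m h = f h * h ^ (1 / 3 : ℝ) := by
    simp only [hf]; rw [mul_assoc, ← Real.rpow_add hh0]; norm_num
  calc m h = f h * h ^ (1 / 3 : ℝ) := e_h
    _ ≤ 6 * K₁ * h ^ (1 / 3 : ℝ) :=
        mul_le_mul_of_nonneg_right ((hfmax h ⟨hh0, le_rfl⟩).trans hfsm) hrpow0
    _ ≤ max (B / a) (6 * K₁) * h ^ (1 / 3 : ℝ) :=
        mul_le_mul_of_nonneg_right (le_max_right _ _) hrpow0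

end RestrictedODE

/-! ## Part B. The restricted integration step on the torus -/

section TorusRestricted

variable {d L : ℕ} [NeZero L]

/-- **`M_L(β, h) ≤ β χ_L(β, 0) h`** for `β, h ≥ 0`: the tangent line at the origin bounds the
concave function `h ↦ M_L(β, h)` (`M_L(β,0) = 0`, `∂M_L/∂h(0) = β χ_L(β, 0)`; chord slopes through
the origin decrease, `torusMag_div_le_torusMag_div`, and tend to the derivative). [cite: FernandezFrohlichSokalSpringer1992, §14.4.2, Step 1 (weak GHS inequality), p. 352] -/
theorem torusMag_le_susc_zero_mul {β h : ℝ} (hβ : 0 ≤ β) (hh : 0 ≤ h) :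
    torusMag d L β h ≤ β * torusSusc d L β 0 * h := by
  rcases hh.lt_or_eq with hh0 | hh0
  swap
  · rw [← hh0, torusMag_zero_field, mul_zero]
  have hder := hasDerivAt_torusMag (d := d) (L := L) β 0
  have hsl : Tendsto (slope (fun h => torusMag d L β h) 0) (𝓝[>] 0) (𝓝 (β * torusSusc d L β 0)) :=
    hder.tendsto_slope.mono_left (nhdsWithin_mono _ fun s hs => ne_of_gt hs)
  have hle : torusMag d L β h / h ≤ β * torusSusc d L β 0 := by
    refine ge_of_tendsto hsl ?_
    filter_upwards [Ioo_mem_nhdsGT hh0] with h' hh'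
    rw [slope_def_field, torusMag_zero_field, sub_zero, sub_zero]
    exact torusMag_div_le_torusMag_div hβ hh'.1 hh'.2.le
  rwa [div_le_iff₀ hh0] at hle

/-- **FFS §14.4.2, Step 1, on one torus at one `β > 0`, restricted form.** If for `h ∈ (0, h₀]`,
`βh₀ ≤ 1`, the inequality `ū₃,L ≤ -κ (βh) χ_L⁴` holds whenever `B βh ≤ a M_L` **and**
`M_L ≤ 33 βh χ_L`, then `M_L(β,h) ≤ max(B/a, 6 (8/(9κ))^{1/3}) (βh)^{1/3}` on `(0, h₀]`
(`le_cbrt_of_afe_ode_restricted` in `s = βh` with `M_L(0) = 0`, `∂M/∂s = χ_L > 0`,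
`∂χ/∂s = ū₃,L ≤ 0`, the weak GHS inequality and `M_L ≤ βχ_L(β,0) h`). [cite: FernandezFrohlichSokalSpringer1992, §14.4.2, Step 1, eqs. (14.278)–(14.281), pp. 352–353] -/
theorem torusMag_le_cbrt_of_afeShapeR {β h₀ κ a B : ℝ} (hβ : 0 < β) (hS : β * h₀ ≤ 1)
    (hκ : 0 < κ) (ha : 0 < a) (hB : 0 ≤ B)
    (hafe : ∀ h ∈ Ioc (0 : ℝ) h₀, B * (β * h) ≤ a * torusMag d L β h →
      torusMag d L β h ≤ 33 * ((β * h) * torusSusc d L β h) →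
      torusU3 d L β h ≤ -(κ * (β * h) * torusSusc d L β h ^ 4)) :
    ∀ h ∈ Ioc (0 : ℝ) h₀, torusMag d L β h ≤
      max (B / a) (6 * (8 / (9 * κ)) ^ (1 / 3 : ℝ)) * (β * h) ^ (1 / 3 : ℝ) := by
  set m : ℝ → ℝ := fun s => torusMag d L β (s / β) with hm
  set χ : ℝ → ℝ := fun s => torusSusc d L β (s / β) with hχ
  set u : ℝ → ℝ := fun s => torusU3 d L β (s / β) with hu
  have hββ : ∀ s : ℝ, β * (s / β) = s := fun s => by field_simp
  have hdiv : ∀ s, HasDerivAt (fun s : ℝ => s / β) (1 / β) s := fun s => by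
    simpa using (hasDerivAt_id s).div_const β
  have hmder : ∀ s, HasDerivAt m (χ s) s := by
    intro s
    have h1 := (hasDerivAt_torusMag (d := d) (L := L) β (s / β)).comp s (hdiv s)
    have h2 : β * torusSusc d L β (s / β) * (1 / β) = χ s := by
      simp only [hχ]; field_simp
    exact h2 ▸ h1
  have hχder : ∀ s, HasDerivAt χ (u s) s := by
    intro s
    have h1 := (hasDerivAt_torusSusc (d := d) (L := L) β (s / β)).comp s (hdiv s)
    have h2 : β * torusU3 d L β (s / β) * (1 / β) = u s := by
      simp only [hu]; field_simp
    exact h2 ▸ h1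
  have hlin : ∀ s ∈ Ioc (0 : ℝ) (β * h₀), m s ≤ torusSusc d L β 0 * s := by
    intro s hs
    have h1 := torusMag_le_susc_zero_mul (d := d) (L := L) hβ.le (div_pos hs.1 hβ).le (β := β)
      (h := s / β)
    have e : β * torusSusc d L β 0 * (s / β) = torusSusc d L β 0 * s := by field_simp
    simpa only [hm, e] using h1
  have hslope : ∀ s ∈ Ioc (0 : ℝ) (β * h₀), ∀ s' ∈ Ioc (0 : ℝ) s, m s / s ≤ m s' / s' := by
    intro s hs s' hs'
    have h1 := torusMag_div_le_torusMag_div (d := d) (L := L) hβ.le (h := s / β) (h' := s' / β)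
      (div_pos hs'.1 hβ) (div_le_div_of_nonneg_right hs'.2 hβ.le)
    have e : ∀ t : ℝ, torusMag d L β (t / β) / (t / β) / β = m t / t := fun t => by
      rw [div_div, div_mul_cancel₀ t hβ.ne']
    rw [← e, ← e]
    exact div_le_div_of_nonneg_right h1 hβ.le
  have hχpos : ∀ s ∈ Ioc (0 : ℝ) (β * h₀), 0 < χ s := fun s hs =>
    torusSusc_pos hβ.le (div_pos hs.1 hβ).le
  have hu0 : ∀ s ∈ Ioc (0 : ℝ) (β * h₀), u s ≤ 0 := fun s hs =>
    torusU3_nonpos hβ.le (div_pos hs.1 hβ).le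
  have hafe' : ∀ s ∈ Ioc (0 : ℝ) (β * h₀), B * s ≤ a * m s → m s ≤ 33 * (s * χ s) →
      u s ≤ -(κ * s * χ s ^ 4) := by
    intro s hs hsmall hr
    have hsβ : s / β ∈ Ioc 0 h₀ :=
      ⟨div_pos hs.1 hβ, by rw [div_le_iff₀ hβ]; linarith [hs.2]⟩
    have key := hafe (s / β) hsβ (by rw [hββ]; exact hsmall) (by rw [hββ]; exact hr)
    rw [hββ] at key
    exact key
  have main := le_cbrt_of_afe_ode_restricted (S := β * h₀) hS ha hB hκ (fun s _ => hmder s)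
    (fun s _ => hχder s) hlin hslope hχpos hu0 hafe'
  intro h hh
  have hs : β * h ∈ Ioc 0 (β * h₀) := ⟨mul_pos hβ hh.1, mul_le_mul_of_nonneg_left hh.2 hβ.le⟩
  have := main (β * h) hs
  have e : m (β * h) = torusMag d L β h := by
    simp only [hm, mul_div_cancel_left₀ h hβ.ne']
  rwa [e] at this

end TorusRestricted

/-! ## Part C. From the restricted shape on large tori below `β_c` to the critical isotherm and the target -/

section ShapeRestricted

variable {d : ℕ}

/-- **The critical-isotherm bound from a restricted Aizenman–Fernández-type inequality on large
tori below `β_c`.** If for `d ≥ 5` there are `β₀ < β_c`, `h₀, κ, a > 0`, `B ≥ 0` such that for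
every `β ∈ (β₀, β_c)`, `β > 0`, all large tori satisfy, for `h ∈ (0, h₀]`,
`B βh ≤ a M_L ∧ M_L ≤ 33 βh χ_L ⟹ ū₃,L ≤ -κ (βh) χ_L⁴`, then `⟨σ_0⟩⁺_{β_c,h} ≤ C h^{1/3}` for
small `h > 0` (`torusMag_le_cbrt_of_afeShapeR` with `h₁ = min(h₀, 1/β_c)`, then
`criticalIsotherm_le_cbrt_of_torusMag_le`). [cite: FernandezFrohlichSokalSpringer1992, §14.4.2, Step 1, eqs. (14.278)–(14.282), pp. 352–353] [cite: AizenmanFernandezJSP1986, §2.1, eqs. (2.2)–(2.4), p. 401, and abstract (δ = 3, d > 4)] -/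
theorem criticalIsotherm_le_cbrt_of_torusShapeR
    (H : ∀ ⦃d : ℕ⦄, 5 ≤ d → ∃ β₀ h₀ κ a B : ℝ, β₀ < criticalBeta d ∧ 0 < h₀ ∧ 0 < κ ∧ 0 < a ∧
      0 ≤ B ∧ ∀ β ∈ Set.Ioo β₀ (criticalBeta d), 0 < β → ∃ L₀ : ℕ, ∀ L : ℕ, L₀ ≤ L →
        ∀ [NeZero L], ∀ h ∈ Set.Ioc (0 : ℝ) h₀, B * (β * h) ≤ a * torusMag d L β h →
          torusMag d L β h ≤ 33 * ((β * h) * torusSusc d L β h) →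
          torusU3 d L β h ≤ -(κ * (β * h) * torusSusc d L β h ^ 4)) :
    ∀ ⦃d : ℕ⦄, 5 ≤ d → ∃ C h₁ : ℝ, 0 < h₁ ∧ ∀ h ∈ Set.Ioo (0 : ℝ) h₁,
      magnetizationInField d (criticalBeta d) h ≤ C * h ^ (1 / 3 : ℝ) := by
  refine criticalIsotherm_le_cbrt_of_torusMag_le fun d hd => ?_
  obtain ⟨β₀, h₀, κ, a, B, hβ₀, hh₀, hκ, ha, hB, hH⟩ := H hd
  have hβc : 0 < criticalBeta d := criticalBeta_pos_holds (d := d) (by omega)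
  set K : ℝ := max (B / a) (6 * (8 / (9 * κ)) ^ (1 / 3 : ℝ)) with hK
  have hK0 : 0 ≤ K := le_max_of_le_left (div_nonneg hB ha.le)
  have hic : (0 : ℝ) < 1 / criticalBeta d := by positivity
  refine ⟨K * criticalBeta d ^ (1 / 3 : ℝ), min h₀ (1 / criticalBeta d), β₀, lt_min hh₀ hic, hβ₀,
    fun β hβ hβ0 => ?_⟩
  obtain ⟨L₀, hL₀⟩ := hH β hβ hβ0
  refine ⟨L₀, fun L hL _ h hh => ?_⟩
  have hS : β * min h₀ (1 / criticalBeta d) ≤ 1 := by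
    have h2 : β * min h₀ (1 / criticalBeta d) ≤ criticalBeta d * (1 / criticalBeta d) :=
      mul_le_mul hβ.2.le (min_le_right _ _) (by positivity) hβc.le
    rwa [mul_one_div_cancel hβc.ne'] at h2
  have step := torusMag_le_cbrt_of_afeShapeR (d := d) (L := L) hβ0 hS hκ ha hB
    (fun h' hh' hsm hr => hL₀ L hL h' ⟨hh'.1, hh'.2.trans (min_le_left _ _)⟩ hsm hr) h ⟨hh.1, hh.2.le⟩
  calc torusMag d L β h ≤ K * (β * h) ^ (1 / 3 : ℝ) := step
    _ = K * β ^ (1 / 3 : ℝ) * h ^ (1 / 3 : ℝ) := by rw [Real.mul_rpow hβ0.le hh.1.le, mul_assoc]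
    _ ≤ K * criticalBeta d ^ (1 / 3 : ℝ) * h ^ (1 / 3 : ℝ) := by
        have h1 : β ^ (1 / 3 : ℝ) ≤ criticalBeta d ^ (1 / 3 : ℝ) :=
          Real.rpow_le_rpow hβ0.le hβ.2.le (by norm_num)
        have h2 : 0 ≤ h ^ (1 / 3 : ℝ) := Real.rpow_nonneg hh.1.le _
        exact mul_le_mul_of_nonneg_right (mul_le_mul_of_nonneg_left h1 hK0) h2

/-- **The target from a restricted Aizenman–Fernández-type inequality on large tori below `β_c`**
(`criticalIsotherm_le_cbrt_of_torusShapeR` and the extrapolation principle,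
`spontaneousMagnetization_le_sqrt_of_criticalIsotherm`). [cite: FernandezFrohlichSokalSpringer1992, §14.4.2, Steps 1–2(a), eqs. (14.278)–(14.284), pp. 352–353] [cite: AizenmanFernandezJSP1986, abstract and §1 (β = 1/2 for nearest-neighbour models, d > 4; Zbl 0629.60106)] -/
theorem spontaneousMagnetization_le_sqrt_of_torusShapeR
    (H : ∀ ⦃d : ℕ⦄, 5 ≤ d → ∃ β₀ h₀ κ a B : ℝ, β₀ < criticalBeta d ∧ 0 < h₀ ∧ 0 < κ ∧ 0 < a ∧
      0 ≤ B ∧ ∀ β ∈ Set.Ioo β₀ (criticalBeta d), 0 < β → ∃ L₀ : ℕ, ∀ L : ℕ, L₀ ≤ L →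
        ∀ [NeZero L], ∀ h ∈ Set.Ioc (0 : ℝ) h₀, B * (β * h) ≤ a * torusMag d L β h →
          torusMag d L β h ≤ 33 * ((β * h) * torusSusc d L β h) →
          torusU3 d L β h ≤ -(κ * (β * h) * torusSusc d L β h ^ 4)) :
    spontaneousMagnetization_le_sqrt :=
  spontaneousMagnetization_le_sqrt_of_criticalIsotherm (criticalIsotherm_le_cbrt_of_torusShapeR H)

end ShapeRestricted

end Literature.Probability.LatticeModels
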